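import Literature.Geometry.Kaehler.DeformationEquivalence
import Literature.Geometry.Hyperkaehler.IrreducibleSymplectic
import Literature.AlgebraicTopology.SingularHomology.SingularCochains
import HarnessLib

/-!
# Automorphisms acting trivially on `H²` form a local system along smooth proper families of
# irreducible symplectic manifolds (Hassett–Tschinkel 2013, Thm. 2.1) — DEFINITIONS + NAMED FACT

Layer `Literature/Geometry/Hyperkaehler` (complex-geometric notions of hyperkähler geometry; the
scheme-side records live in `Literature/AlgebraicGeometry/Hyperkaehler`).  Typed for the
cross-ladder literature layer of ladder HodgeAV, rung H3 (cell `hodge-kum4`, sub-home `lit-family`,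
tranche LT-H3 (a)): the FAMILY-LEVEL statement behind the cell's print-synthesis record
`Literature.AlgebraicGeometry.Hyperkaehler.HassettTschinkel2013_Oguiso2020_fixedPointScheme_translation_kum4Type`
(whose module docstring lists «no family-level statement (local system `Aut°(𝒳/B)`)» under "What is
NOT here").  GRADE: REFEREED (Mosc. Math. J. 13 (2013) 33–56).

## Source (read at the page: held arXiv text `paper:arxiv-1004.0046`, p. 3)

B. Hassett, Yu. Tschinkel, *Hodge theory and Lagrangian planes on generalized Kummer fourfolds*,
Mosc. Math. J. 13 (2013) [`HassettTschinkel2013`; arXiv:1004.0046 = `HassettTschinkel2010`], §2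
(p0003 L1–L36), VERBATIM: "Let `X` be an irreducible holomorphic symplectic manifold. Let
`Aut°(X) ⊂ Aut(X)` denote the subgroup of holomorphic automorphisms of `X` acting trivially on
`H¹(T_X)` and preserving the symplectic form `ω`. Since `X` has no vector fields, this is a discrete
group. This is equivalent to the automorphisms acting trivially on `H²(X, ℂ)`, as
`H²(X, ℂ) = H²(𝒪_X) ⊕ H¹(Ω¹_X) ⊕ H⁰(Ω²_X) = ℂω̄ ⊕ (ω ⊗ H¹(T_X)) ⊕ ℂω`. Let `X'` be deformation
equivalent to `X`, i.e., there exists a connected complex manifold `B`, with distinguished points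
`b` and `b'`, and a proper family of complex manifolds `π : 𝒳 → B` with `𝒳_b := π⁻¹(b) = X` and
`𝒳_{b'} = π⁻¹(b') = X'`. **Theorem 2.1.** `Aut°(X)` is a deformation invariant of `X`, i.e., there
exists a local system of groups `Aut°(𝒳/B) → B` acting on `𝒳 → B`, such that for each `b' ∈ B`
the fiber is isomorphic to `Aut°(X')`."  Proof (p0003 L38–L53): "Consider a local universal
deformation space of `X`, `ψ : 𝒰 → Δ` […]. The completeness of this family implies we can
construct this equivariantly for the action of `Aut(X)` […]. However, `Aut°(X)` acts trivially on
the tangent space `T₀Δ = H¹(T_X)`, thus acts trivially on `Δ` as well. It follows that `Aut°(X)`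
acts fiberwise on `𝒰 → Δ`. Let `Aut°(𝒳/B)` denote the group over `B` classifying automorphisms
acting trivially on `H²(𝒳_b)` for each `b ∈ B`. The previous analysis shows `Aut°(𝒳/B) → B` is a
local homeomorphism. It remains to show this is universally closed. […] A result of Fujiki [Fu81]
implies `φ` is an isomorphism."

## Rendering (tree carriers) and faithfulness

Complex manifolds are charted spaces on finite-dimensional complex normed spaces with holomorphic
atlas (`[IsManifold 𝓘(ℂ, E) ω M]`), as in `Geometry/Kaehler/DeformationEquivalence`; families are
`Geometry.Kaehler.IsProperHolomorphicSubmersion E𝒳 EB π` (Voisin I Def. 9.2 = Kodaira Def. 2.8),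
fibres are read through fibre identifications `Geometry.Kaehler.IsFibreEmbedding X E𝒳 π b ι`
("`X ≅ 𝒳_b`"), cohomology is the tree's singular cohomology `singularCohomology ℂ ℂ M 2 = H²(M; ℂ)`.

* `holAutGroup E M ≤ (M ≃ₜ M)` — the group of BIHOLOMORPHIC self-maps of `M` (homeomorphisms `φ`
  with `φ`, `φ⁻¹` holomorphic), a subgroup of Mathlib's group of self-homeomorphisms (pattern of the
  tree's `holAut` for Riemann surfaces).
* `holAutZero E M ≤ holAutGroup E M` — **`Aut°(M)`**: the biholomorphic self-maps acting trivially
  on `H²(M; ℂ)` (`φ^* = 𝟙` on `singularCohomology ℂ ℂ M 2`) — Hassett–Tschinkel's second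
  description ("equivalent to the automorphisms acting trivially on `H²(X, ℂ)`"), which is the one
  that makes sense for every compact complex manifold and matches the scheme-side
  `AlgebraicGeometry.Hyperkaehler.autZero X` (`complexBetti = H²(X(ℂ); ℂ)`).
* THE FACT `HassettTschinkel2013_holAutZero_localSystem` renders "there exists a local system of
  groups `Aut°(𝒳/B) → B` acting on `𝒳 → B` with fibre `Aut°(𝒳_b)` at every `b`" by what a local
  system of groups acting on the family IS, locally: for every point `b₀ ∈ B` and every
  identification `ι₀ : X₀ ≅ 𝒳_{b₀}` there are a connected open neighbourhood `U ∋ b₀` and, for each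
  `g ∈ Aut°(X₀)`, a self-map `Φ g` of `𝒳`, HOLOMORPHIC on `π⁻¹(U)`, FIBREWISE (`π ∘ Φ g = π` on
  `π⁻¹(U)`), EXTENDING `g` (`Φ g ∘ ι₀ = ι₀ ∘ g`), multiplicative in `g` with `Φ 1 = id` on `π⁻¹(U)`
  (so each `Φ g` is a biholomorphic automorphism of `π⁻¹(U)` over `U` — the continuous sections of
  the local system through the elements of the stalk at `b₀`, i.e. a trivialisation
  `Aut°(𝒳/B)|_U ≅ U × Aut°(X₀)`), such that over EVERY `b ∈ U` and every identification
  `ι : X ≅ 𝒳_b`, restriction to the fibre is a BIJECTION `Aut°(X₀) → Aut°(X)`: each `Φ g` restricts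
  to some `h ∈ Aut°(X)` (`Φ g ∘ ι = ι ∘ h`) and each `h ∈ Aut°(X)` is the restriction of exactly one
  `Φ g` ("for each `b'` the fiber is isomorphic to `Aut°(X')`", the fibre of `Aut°(𝒳/B)` at `b'`
  CLASSIFYING the automorphisms of `𝒳_{b'}` trivial on `H²`, proof L44–L45).  The GLOBAL clause
  (`Aut°(𝒳_b) ≅ Aut°(𝒳_{b'})` for all `b, b' ∈ B`, "deformation invariant") follows from the local
  one (the set of `b` with `Aut°(𝒳_b) ≅ Aut°(X₀)` is open and closed in the connected `B`); it is
  not part of the fact but PROVED from it: `HassettTschinkel2013_holAutZero_localSystem.nonempty_mulEquiv`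
  (with the local form `….exists_nhds_mulEquiv`), appended 2026-08-26.
* HYPOTHESES.  As printed: `B` a connected complex manifold, `π` a proper (holomorphic) family of
  complex manifolds, total space and base Hausdorff and second countable (standing conventions, as in
  `Geometry.Kaehler.IsDeformationOf`).  The source lets `X = 𝒳_b` be irreducible holomorphic
  symplectic and USES, at every fibre, that automorphisms trivial on `H²` act trivially on `H¹(T)`
  (the decomposition `H² ⊇ ω ⊗ H¹(T)` of a symplectic manifold) and the birational geometry of
  holomorphic symplectic manifolds ([Hu99], [Hu03], Fujiki); we therefore REQUIRE EVERY FIBRE to be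
  an irreducible symplectic manifold (`Geometry.Hyperkaehler.IsIrreducibleSymplectic`, Huybrechts
  1999 Def. 1.1, through some fibre identification) — the setting of the theorem (deformations of
  irreducible symplectic manifolds); this is FAITHFUL-TO-WEAKER (more hypotheses than a literal
  reading in which only `𝒳_b` is assumed symplectic), never stronger.
* NOT CLAIMED: finiteness of `Aut°` (Huybrechts; "discrete" in the source), holomorphy of the action
  in the base direction beyond each `Φ g` being holomorphic on `π⁻¹(U)`, anything about `H³` or about
  the subgroup `Γ ⊂ Aut°` of the `Kumⁿ` literature, any fixed-locus statement (those are the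
  companion records: Cartan's holomorphic linearisation `Geometry/Kaehler/FiniteGroupHolomorphicLinearization`,
  and the proved "counting sheets" lemmas `Literature.Topology.IsLocalHomeomorph.ncard_preimage_eq`).

## Contents

`holAutGroup`, `holAutZero` with unfolding / closure API (proved), ONE named fact
`HassettTschinkel2013_holAutZero_localSystem` (REFEREED; not proved here — Kuranishi theory, the
global Torelli-type separation argument and Fujiki's theorem are not in Mathlib), and its PROVED
consequences `….exists_nhds_mulEquiv` / `….nonempty_mulEquiv` (the printed headline: `Aut°` of any
two fibres are isomorphic groups).  No instances, no notation, no `sorry`.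
-/

noncomputable section

open scoped Manifold ContDiff Topology
open Function Set CategoryTheory
open Literature.Geometry.Kaehler
open Literature.AlgebraicTopology.SingularHomology

universe u v

namespace Literature.Geometry.Hyperkaehler

/-! ### Biholomorphic automorphisms of a complex manifold and `Aut°` -/

section Aut

variable (E : Type u) [NormedAddCommGroup E] [NormedSpace ℂ E]
  (M : Type v) [TopologicalSpace M] [ChartedSpace E M]

/-- **The group of biholomorphic self-maps** of the complex manifold `M` (charted on `E`): the
self-homeomorphisms `φ` of `M` such that `φ` and `φ⁻¹` are holomorphic
(`ContMDiff 𝓘(ℂ, E) 𝓘(ℂ, E) ω`), as a subgroup of Mathlib's group `M ≃ₜ M`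
(`f * g = g.trans f`).  Hassett–Tschinkel's `Aut(X)`. [cite: HassettTschinkel2013, §2 (p. 3)] -/
def holAutGroup : Subgroup (M ≃ₜ M) where
  carrier := {φ | ContMDiff 𝓘(ℂ, E) 𝓘(ℂ, E) ω (φ : M → M) ∧
    ContMDiff 𝓘(ℂ, E) 𝓘(ℂ, E) ω (φ.symm : M → M)}
  one_mem' := ⟨contMDiff_id, contMDiff_id⟩
  mul_mem' := by
    rintro φ ψ ⟨hφ, hφ'⟩ ⟨hψ, hψ'⟩
    exact ⟨hφ.comp hψ, hψ'.comp hφ'⟩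
  inv_mem' := by
    rintro φ ⟨hφ, hφ'⟩
    exact ⟨hφ', hφ⟩

variable {E M} in
/-- Unfolding: `φ` is a biholomorphic self-map iff `φ` and `φ⁻¹` are holomorphic.
[cite: HassettTschinkel2013, §2 (p. 3)] -/
theorem mem_holAutGroup_iff (φ : M ≃ₜ M) :
    φ ∈ holAutGroup E M ↔ ContMDiff 𝓘(ℂ, E) 𝓘(ℂ, E) ω (φ : M → M) ∧
      ContMDiff 𝓘(ℂ, E) 𝓘(ℂ, E) ω (φ.symm : M → M) :=
  Iff.rfl

/-- **`Aut°(M)`** (Hassett–Tschinkel): the biholomorphic self-maps of `M` acting trivially on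
`H²(M; ℂ)` — `φ^* = 𝟙` on the singular cohomology `singularCohomology ℂ ℂ M 2` ("This is equivalent
to the automorphisms acting trivially on `H²(X, ℂ)`").  For an irreducible symplectic `M` this is the
printed `Aut°(M)` (automorphisms acting trivially on `H¹(T_M)` and preserving the symplectic form);
the analytic counterpart of the scheme-side `AlgebraicGeometry.Hyperkaehler.autZero`.
[cite: HassettTschinkel2013, §2 (p. 3)] -/
def holAutZero : Subgroup (M ≃ₜ M) where
  carrier := {φ | φ ∈ holAutGroup E M ∧
    singularCohomology.map ℂ ℂ (φ : C(M, M)) 2 = 𝟙 _}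
  one_mem' := by
    refine ⟨(holAutGroup E M).one_mem, ?_⟩
    have h : ((1 : M ≃ₜ M) : C(M, M)) = ContinuousMap.id M := ContinuousMap.ext fun _ => rfl
    rw [h]
    exact singularCohomology.map_id ℂ ℂ 2
  mul_mem' := by
    rintro φ ψ ⟨hφ, hφ2⟩ ⟨hψ, hψ2⟩
    refine ⟨(holAutGroup E M).mul_mem hφ hψ, ?_⟩
    have h : ((φ * ψ : M ≃ₜ M) : C(M, M)) = (φ : C(M, M)).comp (ψ : C(M, M)) :=
      ContinuousMap.ext fun _ => rfl
    rw [h, singularCohomology.map_comp, hφ2, hψ2, Category.comp_id]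
  inv_mem' := by
    rintro φ ⟨hφ, hφ2⟩
    refine ⟨(holAutGroup E M).inv_mem hφ, ?_⟩
    have h : ((φ⁻¹ * φ : M ≃ₜ M) : C(M, M)) = ((φ⁻¹ : M ≃ₜ M) : C(M, M)).comp (φ : C(M, M)) :=
      ContinuousMap.ext fun _ => rfl
    have h0 : ((φ⁻¹ * φ : M ≃ₜ M) : C(M, M)) = ContinuousMap.id M :=
      ContinuousMap.ext fun x => by simp
    have h1 : singularCohomology.map ℂ ℂ ((φ⁻¹ * φ : M ≃ₜ M) : C(M, M)) 2 = 𝟙 _ := by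
      rw [h0]; exact singularCohomology.map_id ℂ ℂ 2
    rw [h, singularCohomology.map_comp, hφ2, Category.comp_id] at h1
    exact h1

variable {E M} in
/-- Unfolding: `φ ∈ Aut°(M)` iff `φ` is biholomorphic and `φ^* = 𝟙` on `H²(M; ℂ)`.
[cite: HassettTschinkel2013, §2 (p. 3)] -/
theorem mem_holAutZero_iff (φ : M ≃ₜ M) :
    φ ∈ holAutZero E M ↔ φ ∈ holAutGroup E M ∧
      singularCohomology.map ℂ ℂ (φ : C(M, M)) 2 = 𝟙 _ :=
  Iff.rfl

variable {E M} in
/-- `Aut°(M) ≤ Aut(M)`. [cite: HassettTschinkel2013, §2 (p. 3)] -/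
theorem holAutZero_le_holAutGroup : holAutZero E M ≤ holAutGroup E M :=
  fun φ h => ((mem_holAutZero_iff φ).1 h).1

end Aut

/-! ### Irreducible symplectic structure on a bundled complex manifold -/

/-- The bundled complex manifold `X` (`Geometry.Kaehler.ComplexManifold`: model + carrier with
holomorphic atlas) **is an irreducible symplectic manifold** in the sense of Huybrechts 1999
Def. 1.1 (`IsIrreducibleSymplectic`), its real `C^∞` structure being the one underlying the complex
structure (`Geometry.Kaehler.isManifold_real_of_isManifold_complex`, not an instance in the tree).
[cite: Huybrechts1999, §1 Def. 1.1] -/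
def _root_.Literature.Geometry.Kaehler.ComplexManifold.IsIrreducibleSymplectic
    (X : ComplexManifold.{u}) : Prop :=
  @Literature.Geometry.Hyperkaehler.IsIrreducibleSymplectic X.model _ _ X _ _
    isManifold_real_of_isManifold_complex _ _

/-- Unfolding. [cite: Huybrechts1999, §1 Def. 1.1] -/
theorem _root_.Literature.Geometry.Kaehler.ComplexManifold.isIrreducibleSymplectic_iff
    (X : ComplexManifold.{u}) :
    X.IsIrreducibleSymplectic ↔
      @Literature.Geometry.Hyperkaehler.IsIrreducibleSymplectic X.model _ _ X _ _
        isManifold_real_of_isManifold_complex _ _ :=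
  Iff.rfl

/-! ### Hassett–Tschinkel 2013, Theorem 2.1 — the named fact -/

/-- **Hassett–Tschinkel 2013, Thm. 2.1: `Aut°` is a deformation invariant — along a proper
holomorphic submersion of irreducible symplectic manifolds the groups `Aut°(𝒳_b)` form a local
system of groups acting on the family (NAMED FACT, REFEREED).**  For complex manifolds `𝒳`, `B`
(Hausdorff, second countable, `B` connected), a proper holomorphic submersion `π : 𝒳 → B` all of
whose fibres are irreducible symplectic manifolds, a point `b₀ ∈ B` and an identification
`ι₀ : X₀ ≅ 𝒳_{b₀}`: there are a connected open `U ∋ b₀` and self-maps `Φ g` of `𝒳`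
(`g ∈ Aut°(X₀)`), holomorphic and fibre-preserving on `π⁻¹(U)`, extending `g`, multiplicative in `g`
with `Φ 1 = id` on `π⁻¹(U)`, such that for every `b ∈ U` and every identification `ι : X ≅ 𝒳_b`
restriction to the fibre is a bijection `Aut°(X₀) → Aut°(X)` (module docstring: verbatim source with
page locators, rendering, the every-fibre-symplectic hypothesis = FAITHFUL-TO-WEAKER, and what is not
claimed).  Not proved here (Kuranishi families, separation argument, Fujiki).
[cite: HassettTschinkel2013, §2 Thm. 2.1] -/
def HassettTschinkel2013_holAutZero_localSystem : Prop :=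
  ∀ ⦃E𝒳 : Type u⦄ [NormedAddCommGroup E𝒳] [NormedSpace ℂ E𝒳] [FiniteDimensional ℂ E𝒳]
    ⦃𝒳 : Type u⦄ [TopologicalSpace 𝒳] [ChartedSpace E𝒳 𝒳] [IsManifold 𝓘(ℂ, E𝒳) ω 𝒳]
    [T2Space 𝒳] [SecondCountableTopology 𝒳]
    ⦃EB : Type u⦄ [NormedAddCommGroup EB] [NormedSpace ℂ EB] [FiniteDimensional ℂ EB]
    ⦃B : Type u⦄ [TopologicalSpace B] [ChartedSpace EB B] [IsManifold 𝓘(ℂ, EB) ω B]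
    [T2Space B] [SecondCountableTopology B] [ConnectedSpace B]
    ⦃π : 𝒳 → B⦄, IsProperHolomorphicSubmersion E𝒳 EB π →
    -- every fibre `𝒳_b` is an irreducible symplectic manifold
    (∀ b : B, ∃ (X : ComplexManifold.{u}) (ι : X → 𝒳),
        IsFibreEmbedding X.model E𝒳 π b ι ∧ X.IsIrreducibleSymplectic) →
    ∀ (b₀ : B) (X₀ : ComplexManifold.{u}) (ι₀ : X₀ → 𝒳), IsFibreEmbedding X₀.model E𝒳 π b₀ ι₀ →
      ∃ U : Set B, IsOpen U ∧ IsConnected U ∧ b₀ ∈ U ∧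
        ∃ Φ : (X₀ ≃ₜ X₀) → 𝒳 → 𝒳,
          -- sections through the stalk at `b₀`: holomorphic, fibrewise, extending `g`
          (∀ g ∈ holAutZero X₀.model X₀,
              ContMDiffOn 𝓘(ℂ, E𝒳) 𝓘(ℂ, E𝒳) ω (Φ g) (π ⁻¹' U) ∧
              (∀ x ∈ π ⁻¹' U, π (Φ g x) = π x) ∧ (∀ x₀ : X₀, Φ g (ι₀ x₀) = ι₀ (g x₀))) ∧
          -- a local system of GROUPS acting: multiplicative, unital on `π⁻¹(U)`
          (∀ g ∈ holAutZero X₀.model X₀, ∀ h ∈ holAutZero X₀.model X₀,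
              ∀ x ∈ π ⁻¹' U, Φ (g * h) x = Φ g (Φ h x)) ∧
          (∀ x ∈ π ⁻¹' U, Φ 1 x = x) ∧
          -- over every `b ∈ U` the fibre of the local system is `Aut°(𝒳_b)`
          (∀ b ∈ U, ∀ (X : ComplexManifold.{u}) (ι : X → 𝒳), IsFibreEmbedding X.model E𝒳 π b ι →
              (∀ g ∈ holAutZero X₀.model X₀,
                  ∃ h ∈ holAutZero X.model X, ∀ x : X, Φ g (ι x) = ι (h x)) ∧
              (∀ h ∈ holAutZero X.model X,
                  ∃! g : X₀ ≃ₜ X₀, g ∈ holAutZero X₀.model X₀ ∧ ∀ x : X, Φ g (ι x) = ι (h x)))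

/-! ### The global clause: `Aut°` of any two fibres are isomorphic (proved from the fact) -/

section DeformationInvariant

/-- From a local trivialisation of the local system (the data provided by
`HassettTschinkel2013_holAutZero_localSystem` over a neighbourhood `U`): restriction to a fibre
over `U` is a GROUP ISOMORPHISM `A₀ ≃* A` (multiplicativity from `Φ (g h) = Φ g ∘ Φ h`, bijectivity
from the existence-and-uniqueness clause; `ι` injective).  Stated for arbitrary subgroups of
homeomorphism groups (private plumbing). [folklore] -/
private theorem nonempty_mulEquiv_of_restriction {X₀ X 𝒳 : Type*} [TopologicalSpace X₀]
    [TopologicalSpace X] (A₀ : Subgroup (X₀ ≃ₜ X₀)) (A : Subgroup (X ≃ₜ X))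
    (Φ : (X₀ ≃ₜ X₀) → 𝒳 → 𝒳) (ι : X → 𝒳) (hι : Injective ι) (S : Set 𝒳) (hιS : ∀ x, ι x ∈ S)
    (hmul : ∀ g ∈ A₀, ∀ h ∈ A₀, ∀ x ∈ S, Φ (g * h) x = Φ g (Φ h x))
    (hres : ∀ g ∈ A₀, ∃ h ∈ A, ∀ x, Φ g (ι x) = ι (h x))
    (huniq : ∀ h ∈ A, ∃! g : X₀ ≃ₜ X₀, g ∈ A₀ ∧ ∀ x, Φ g (ι x) = ι (h x)) :
    Nonempty (A₀ ≃* A) := by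
  classical
  choose r hrA hr using hres
  -- the restriction map on the subgroup
  let ρ : A₀ → A := fun g => ⟨r g.1 g.2, hrA g.1 g.2⟩
  have hρ : ∀ (g : A₀) (x : X), Φ g.1 (ι x) = ι ((ρ g : X ≃ₜ X) x) := fun g x => hr g.1 g.2 x
  have hρmul : ∀ g h : A₀, ρ (g * h) = ρ g * ρ h := by
    intro g h
    apply Subtype.ext
    ext x
    apply hι
    show ι ((ρ (g * h) : X ≃ₜ X) x) = ι (((ρ g : X ≃ₜ X) * (ρ h : X ≃ₜ X)) x)
    rw [← hρ (g * h) x, Homeomorph.mul_apply, ← hρ g, ← hρ h]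
    exact hmul g.1 g.2 h.1 h.2 (ι x) (hιS x)
  have hρinj : Injective ρ := by
    intro g g' hgg'
    obtain ⟨g₀, -, huq⟩ := huniq (ρ g).1 (ρ g).2
    have h1 : (g : X₀ ≃ₜ X₀) = g₀ := huq g.1 ⟨g.2, fun x => hρ g x⟩
    have h2 : (g' : X₀ ≃ₜ X₀) = g₀ := huq g'.1 ⟨g'.2, fun x => by rw [hgg']; exact hρ g' x⟩
    exact Subtype.ext (h1.trans h2.symm)
  have hρsurj : Surjective ρ := by
    intro h
    obtain ⟨g₀, ⟨hg₀, hg₀'⟩, -⟩ := huniq h.1 h.2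
    refine ⟨⟨g₀, hg₀⟩, Subtype.ext ?_⟩
    ext x
    apply hι
    rw [← hρ ⟨g₀, hg₀⟩ x]
    exact hg₀' x
  exact ⟨MulEquiv.ofBijective (MonoidHom.mk' ρ hρmul) ⟨hρinj, hρsurj⟩⟩

variable {E𝒳 : Type u} [NormedAddCommGroup E𝒳] [NormedSpace ℂ E𝒳] [FiniteDimensional ℂ E𝒳]
  {𝒳 : Type u} [TopologicalSpace 𝒳] [ChartedSpace E𝒳 𝒳] [IsManifold 𝓘(ℂ, E𝒳) ω 𝒳]
  [T2Space 𝒳] [SecondCountableTopology 𝒳]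
  {EB : Type u} [NormedAddCommGroup EB] [NormedSpace ℂ EB] [FiniteDimensional ℂ EB]
  {B : Type u} [TopologicalSpace B] [ChartedSpace EB B] [IsManifold 𝓘(ℂ, EB) ω B]
  [T2Space B] [SecondCountableTopology B] [ConnectedSpace B]
  {π : 𝒳 → B}

/-- **Local form of deformation invariance**: over the trivialising neighbourhood `U` of `b₀`
provided by the fact, `Aut°(X₀) ≅ Aut°(X)` as groups for every fibre identification `ι : X ≅ 𝒳_b`,
`b ∈ U`. [cite: HassettTschinkel2013, §2 Thm. 2.1] -/
theorem HassettTschinkel2013_holAutZero_localSystem.exists_nhds_mulEquiv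
    (h : HassettTschinkel2013_holAutZero_localSystem.{u})
    (hπ : IsProperHolomorphicSubmersion E𝒳 EB π)
    (hIHS : ∀ b : B, ∃ (X : ComplexManifold.{u}) (ι : X → 𝒳),
      IsFibreEmbedding X.model E𝒳 π b ι ∧ X.IsIrreducibleSymplectic)
    (b₀ : B) (X₀ : ComplexManifold.{u}) (ι₀ : X₀ → 𝒳) (hι₀ : IsFibreEmbedding X₀.model E𝒳 π b₀ ι₀) :
    ∃ U : Set B, IsOpen U ∧ b₀ ∈ U ∧
      ∀ b ∈ U, ∀ (X : ComplexManifold.{u}) (ι : X → 𝒳), IsFibreEmbedding X.model E𝒳 π b ι →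
        Nonempty (holAutZero X₀.model X₀ ≃* holAutZero X.model X) := by
  obtain ⟨U, hUo, -, hb₀U, Φ, -, hmul, -, hfib⟩ := h hπ hIHS b₀ X₀ ι₀ hι₀
  refine ⟨U, hUo, hb₀U, fun b hb X ι hι => ?_⟩
  obtain ⟨hres, huniq⟩ := hfib b hb X ι hι
  refine nonempty_mulEquiv_of_restriction (holAutZero X₀.model X₀) (holAutZero X.model X) Φ ι
    hι.isClosedEmbedding.injective (π ⁻¹' U) (fun x => ?_) hmul hres huniq
  show π (ι x) ∈ U
  rw [hι.apply_eq x]; exact hb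

/-- **Hassett–Tschinkel 2013, Thm. 2.1, global clause — `Aut°` is a deformation invariant
(PROVED from the local-system fact):** along a proper holomorphic submersion of irreducible
symplectic manifolds over a connected base, the groups `Aut°` of ANY two fibres are isomorphic
("for each `b' ∈ B` the fiber is isomorphic to `Aut°(X')`").  Proof: the set of `b` whose fibre has
`Aut° ≅ Aut°(X₀)` is open and closed by the local clause, and `B` is connected.
[cite: HassettTschinkel2013, §2 Thm. 2.1] -/
theorem HassettTschinkel2013_holAutZero_localSystem.nonempty_mulEquiv
    (h : HassettTschinkel2013_holAutZero_localSystem.{u})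
    (hπ : IsProperHolomorphicSubmersion E𝒳 EB π)
    (hIHS : ∀ b : B, ∃ (X : ComplexManifold.{u}) (ι : X → 𝒳),
      IsFibreEmbedding X.model E𝒳 π b ι ∧ X.IsIrreducibleSymplectic)
    {b b' : B} {X X' : ComplexManifold.{u}} {ι : X → 𝒳} {ι' : X' → 𝒳}
    (hι : IsFibreEmbedding X.model E𝒳 π b ι) (hι' : IsFibreEmbedding X'.model E𝒳 π b' ι') :
    Nonempty (holAutZero X.model X ≃* holAutZero X'.model X') := by
  classical
  -- `T` = the points whose fibre (through SOME identification) has `Aut° ≅ Aut°(X)`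
  set T : Set B := {c | ∃ (Y : ComplexManifold.{u}) (κ : Y → 𝒳), IsFibreEmbedding Y.model E𝒳 π c κ ∧
    Nonempty (holAutZero X.model X ≃* holAutZero Y.model Y)} with hTdef
  have hbT : b ∈ T := ⟨X, ι, hι, ⟨MulEquiv.refl _⟩⟩
  -- `T` is open
  have hTopen : IsOpen T := by
    rw [isOpen_iff_mem_nhds]
    rintro c ⟨Y, κ, hκ, ⟨e⟩⟩
    obtain ⟨U, hUo, hcU, hU⟩ := h.exists_nhds_mulEquiv hπ hIHS c Y κ hκ
    refine Filter.mem_of_superset (hUo.mem_nhds hcU) fun c' hc' => ?_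
    obtain ⟨Y', κ', hκ', -⟩ := hIHS c'
    obtain ⟨e'⟩ := hU c' hc' Y' κ' hκ'
    exact ⟨Y', κ', hκ', ⟨e.trans e'⟩⟩
  -- `T` is closed
  have hTclosed : IsClosed T := by
    rw [← closure_subset_iff_isClosed]
    intro c hc
    obtain ⟨Y, κ, hκ, -⟩ := hIHS c
    obtain ⟨U, hUo, hcU, hU⟩ := h.exists_nhds_mulEquiv hπ hIHS c Y κ hκ
    obtain ⟨c', hc'U, hc'T⟩ := mem_closure_iff.1 hc U hUo hcU
    obtain ⟨Y', κ', hκ', ⟨e'⟩⟩ := hc'T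
    obtain ⟨e⟩ := hU c' hc'U Y' κ' hκ'
    exact ⟨Y, κ, hκ, ⟨e'.trans e.symm⟩⟩
  have hT : T = univ := IsClopen.eq_univ ⟨hTclosed, hTopen⟩ ⟨b, hbT⟩
  -- conclude at `b'`, first for the witness identification, then for `ι'`
  have hb'T : b' ∈ T := hT ▸ mem_univ b'
  obtain ⟨Y', κ', hκ', ⟨e₁⟩⟩ := hb'T
  obtain ⟨U, hUo, hb'U, hU⟩ := h.exists_nhds_mulEquiv hπ hIHS b' X' ι' hι'
  obtain ⟨e₂⟩ := hU b' hb'U Y' κ' hκ'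
  exact ⟨e₁.trans e₂.symm⟩

end DeformationInvariant

end Literature.Geometry.Hyperkaehler

end
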